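import Literature.AnabelianGeometry.SemiGraphs.PSCIrreducibleNodalShape
import Literature.AnabelianGeometry.SemiGraphs.PSCTwoComponentAffineOrigin
import HarnessLib

/-!
# [CombGC] Prop. 1.2 (i), [IUTchI] Rmk. 1.2.3 (iv) (cuspidal), [CombGC] Thm. 1.6 (i) at irreducible one-nodal data

Mochizuki, *A combinatorial version of the Grothendieck conjecture* [CombGC] §1: Prop. 1.2 (i) p. 8, Thm.
1.6 (i) p. 13; *Inter-universal Teichmüller theory I* [IUTchI] Rmk. 1.2.3 (iv) pp. 41–42
[cite: MochizukiCombGC2007, Thm 1.6(i) p.13] [cite: MochizukiCombGC2007, Prop 1.2(i) p.8]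
[cite: Mochizuki2012, IUTchI Rmk 1.2.3(iv) pp.41-42].  PROOF-ONLY assembly (abc-iut-f-164 gen 2; rows F-0459
`PSCDatum.OpenInterDeterminesComponentHolds`, F-1931 `PSCDatum.CuspidalEdgeLikeCharacterizationHolds`, F-0458
`PSCDatum.NumericallyCuspidalIffHolds`) at the DATA OF IRREDUCIBLE ONE-NODAL SHAPE
(`PSCIrreducibleNodalShape.lean`: one vertex with a loop; `Π` a pro-`Σ` completion `ι : Γ_{g,r} → Π` of the
smoothing, node group `closure ι⟨b_0⟩`, cusp groups `closure ι⟨c_j⟩`, vertex group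
`closure ι⟨b_0, a_0 b_0 a_0⁻¹, a_i, b_i (i ≥ 1), c_j⟩`, genus `g − 1`; `2 ≤ g ∨ 2 ≤ r`).

* `exists_irreducibleNodalDatum`: the shape is INHABITED over the pro-`Σ` completion of every `Γ_{g,r}`,
  `g ≥ 1` (`V = N = Unit`, cusps `Fin r`; the loop's two branch inclusions with trivial conjugator —
  `b_0` is a listed generator of the vertex group).
* `openInterDeterminesComponentHolds_of_irreducibleNodal`, `numericallyCuspidalIffHolds_of_irreducibleNodal`:
  F-0459 and F-0458 (`Σ = {l}`) at every origin of such data (F-1931: the vertex-free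
  `cuspidalEdgeLikeCharacterizationHolds_of_cuspidallyStandard`; F-0458 by abc-iut-f-164's reduction
  `numericallyCuspidalIffHolds_of_characterization`).
* `exists_irreducibleNodalOrigin_thm16i_holds`: for a prime `l`, the origin of these data with `Σ = {l}`
  satisfies F-0459 ∧ F-1931 ∧ F-0458 and is INHABITED by the pro-`l` datum of the TWO-POINTED NODAL
  CUBIC (`Γ_{1,2}`: geometric genus `0`, one node, two marked points).

With `PSCTwoComponentAffinePointedOrigin.lean` / `PSCTwoComponentUnmarkedOrigin.lean` (the strata `Δ_h`)
this covers every ONE-NODAL pointed stable curve shape with at least one marked point except the one-pointed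
nodal cubic `Γ_{1,1}` (see `PSCIrreducibleNodalShape.lean`).  Instance forms at data of the shape of genuine
curves; consistency evidence for the typed rows, not the printed theorems for all pointed stable curves.
Nothing here takes a side on [IUTchIII] Cor. 3.12.
-/

noncomputable section

namespace Literature.AnabelianGeometry.SemiGraphs

open scoped Pointwise
open Literature.GroupTheory.CombinatorialGroupTheory
open SemiGraphOfAnabelioids (IsProSigmaCompletion)

universe u

namespace PSCDatum

/-! ### Data of irreducible one-nodal shape exist -/

/-- **Data of irreducible one-nodal shape exist** over a pro-`Σ` completion `ι : Γ_{g,r} → Π`, `g ≥ 1`: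
one vertex, one node (a loop), cusps `Fin r`; `Π_ν = closure ι⟨b_0⟩`, `Π_{c_j} = closure ι⟨c_j⟩`,
`Π_v = closure ι⟨b_0, a_0 b_0 a_0⁻¹, a_i, b_i (i ≥ 1), c_j⟩`, genus `g − 1`; both branches of the loop
embed `Π_ν` into `Π_v` (trivial conjugators; geometrically the second branch is the `a_0`-conjugate
`closure ι⟨a_0 b_0 a_0⁻¹⟩`, also listed). [cite: MochizukiCombGC2007, Def 1.1 pp.6-7] -/
theorem exists_irreducibleNodalDatum (Sigma : Set ℕ) (hne : Sigma.Nonempty)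
    (hprime : ∀ p ∈ Sigma, p.Prime) (g r : ℕ) (hg : 1 ≤ g) :
    ∃ (Q : ProfiniteGrp.{0}) (ι : PuncturedSurfaceGroup g r →* Q) (G : PSCDatum Q)
      (e : G.graph.C ≃ Fin r) (v₀ : G.graph.V) (n₀ : G.graph.N),
      IsProSigmaCompletion Sigma ι ∧ G.Sigma = Sigma ∧ G.graph.i = 1 ∧ G.graph.n = 1 ∧ G.graph.r = r ∧
      (∀ c, G.cuspGp c =
        ((PuncturedSurfaceGroup.cuspInertia (g := g) (e c)).map ι).topologicalClosure) ∧
      (∀ w, w = v₀) ∧ (∀ n, n = n₀) ∧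
      G.nodeGp n₀ = ((Subgroup.zpowers (PuncturedSurfaceGroup.b (r := r) (⟨0, hg⟩ : Fin g))).map
        ι).topologicalClosure ∧
      G.vertGp v₀ = ((Subgroup.closure {x : PuncturedSurfaceGroup g r |
            x = PuncturedSurfaceGroup.b ⟨0, hg⟩ ∨
            x = PuncturedSurfaceGroup.a ⟨0, hg⟩ * PuncturedSurfaceGroup.b ⟨0, hg⟩ * (PuncturedSurfaceGroup.a ⟨0, hg⟩)⁻¹ ∨
            (∃ i : Fin g, 1 ≤ (i : ℕ) ∧ (x = PuncturedSurfaceGroup.a i ∨ x = PuncturedSurfaceGroup.b i)) ∨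
            ∃ j : Fin r, x = PuncturedSurfaceGroup.c j}).map ι).topologicalClosure ∧
      G.genus v₀ = g - 1 ∧ (∀ n, G.graph.nodeEnds n = s(v₀, v₀)) := by
  classical
  obtain ⟨Q, ι, hι⟩ :=
    IsProSigmaCompletion.exists_isProSigmaCompletion (PuncturedSurfaceGroup g r) Sigma
  let S₀ : Set (PuncturedSurfaceGroup g r) := {x : PuncturedSurfaceGroup g r |
            x = PuncturedSurfaceGroup.b ⟨0, hg⟩ ∨
            x = PuncturedSurfaceGroup.a ⟨0, hg⟩ * PuncturedSurfaceGroup.b ⟨0, hg⟩ * (PuncturedSurfaceGroup.a ⟨0, hg⟩)⁻¹ ∨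
            (∃ i : Fin g, 1 ≤ (i : ℕ) ∧ (x = PuncturedSurfaceGroup.a i ∨ x = PuncturedSurfaceGroup.b i)) ∨
            ∃ j : Fin r, x = PuncturedSurfaceGroup.c j}
  let A₀ : Subgroup Q := ((Subgroup.closure S₀).map ι).topologicalClosure
  have hb : PuncturedSurfaceGroup.b (r := r) (⟨0, hg⟩ : Fin g) ∈ Subgroup.closure S₀ :=
    Subgroup.subset_closure (Or.inl rfl)
  have hN₀ : ((Subgroup.zpowers (PuncturedSurfaceGroup.b (r := r) (⟨0, hg⟩ : Fin g))).map
      ι).topologicalClosure ≤ A₀ :=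
    Subgroup.topologicalClosure_mono (Subgroup.map_mono ((Subgroup.zpowers_le).mpr hb))
  let T : PSCDatum Q :=
    { Sigma := Sigma
      sigma_prime := hprime
      sigma_nonempty := hne
      graph := { V := Unit, N := Unit, C := Fin r, nodeEnds := fun _ => s((), ()), cuspEnd := fun _ => () }
      vertGp := fun _ => A₀
      nodeGp := fun _ => ((Subgroup.zpowers (PuncturedSurfaceGroup.b (r := r) (⟨0, hg⟩ : Fin g))).map
        ι).topologicalClosure
      cuspGp := fun j => ((PuncturedSurfaceGroup.cuspInertia (g := g) j).map ι).topologicalClosure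
      genus := fun _ => g - 1
      isClosed_vertGp := fun _ => Subgroup.isClosed_topologicalClosure _
      isClosed_nodeGp := fun _ => Subgroup.isClosed_topologicalClosure _
      isClosed_cuspGp := fun _ => Subgroup.isClosed_topologicalClosure _
      nodeGp_le := fun _ => ⟨(), (), rfl, ⟨1, by rw [one_smul]; exact hN₀⟩, ⟨1, by rw [one_smul]; exact hN₀⟩⟩
      cuspGp_le := fun j => ⟨1, by
        rw [one_smul]
        exact Subgroup.topologicalClosure_mono (Subgroup.map_mono ((Subgroup.zpowers_le).mpr
          (Subgroup.subset_closure (Or.inr (Or.inr (Or.inr ⟨j, rfl⟩))))))⟩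
      proSigma := isProSigma_of_isProSigmaCompletion hι }
  exact ⟨Q, ι, T, Equiv.refl _, (), (), hι, rfl, rfl, rfl, Fintype.card_fin r, fun _ => rfl,
    fun w => rfl, fun n => rfl, rfl, rfl, rfl, fun _ => rfl⟩

/-! ### F-0459 and F-0458 at origins of irreducible one-nodal data -/

section Origin

variable (Ω : PSCOrigin.{u}) (l : ℕ)

/-- **F-0459 / [CombGC] Prop. 1.2 (i) at every origin whose data are of irreducible one-nodal shape**
(profinite `Π`; `2 ≤ g ∨ 2 ≤ r`). [cite: MochizukiCombGC2007, Prop 1.2(i) p.8] -/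
theorem openInterDeterminesComponentHolds_of_irreducibleNodal
    (hΩ : ∀ ⦃Q : Type u⦄ [Group Q] [TopologicalSpace Q] [IsTopologicalGroup Q] (G : PSCDatum Q),
      Ω.IsOfPSCType G → CompactSpace Q ∧ T2Space Q ∧ TotallyDisconnectedSpace Q ∧
        ∃ (S : Set ℕ) (g r : ℕ) (hg : 1 ≤ g) (ι : PuncturedSurfaceGroup g r →* Q) (e : G.graph.C ≃ Fin r)
          (v₀ : G.graph.V) (n₀ : G.graph.N),
          S.Nonempty ∧ (∀ p ∈ S, p.Prime) ∧ IsProSigmaCompletion S ι ∧ (2 ≤ g ∨ 2 ≤ r) ∧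
          (∀ c, G.cuspGp c =
            ((PuncturedSurfaceGroup.cuspInertia (g := g) (e c)).map ι).topologicalClosure) ∧
          (∀ w, w = v₀) ∧ (∀ n, n = n₀) ∧
          G.nodeGp n₀ = ((Subgroup.zpowers (PuncturedSurfaceGroup.b (r := r) (⟨0, hg⟩ : Fin g))).map
            ι).topologicalClosure ∧
          G.vertGp v₀ = ((Subgroup.closure {x : PuncturedSurfaceGroup g r |
            x = PuncturedSurfaceGroup.b ⟨0, hg⟩ ∨
            x = PuncturedSurfaceGroup.a ⟨0, hg⟩ * PuncturedSurfaceGroup.b ⟨0, hg⟩ * (PuncturedSurfaceGroup.a ⟨0, hg⟩)⁻¹ ∨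
            (∃ i : Fin g, 1 ≤ (i : ℕ) ∧ (x = PuncturedSurfaceGroup.a i ∨ x = PuncturedSurfaceGroup.b i)) ∨
            ∃ j : Fin r, x = PuncturedSurfaceGroup.c j}).map ι).topologicalClosure ∧
          G.genus v₀ = g - 1) :
    OpenInterDeterminesComponentHolds Ω := by
  intro Q _ _ _ G hG
  obtain ⟨hc, ht, hd, S, g, r, hg, ι, e, v₀, n₀, hne, hprime, hι, hgr, hC, hV, hN, hE, -, -⟩ := hΩ G hG
  exact G.openInterDeterminesComponent_of_irreducibleNodal hne hprime ι hι hg hgr e hC v₀ hV n₀ hN hE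

/-- **F-0458 / [CombGC] Thm. 1.6 (i) as printed at every origin whose data are of irreducible one-nodal
shape, `Σ = {l}`** (abc-iut-f-164's reduction `numericallyCuspidalIffHolds_of_characterization` from F-0459
above and the vertex-free F-1931). [cite: MochizukiCombGC2007, Thm 1.6(i) p.13] -/
theorem numericallyCuspidalIffHolds_of_irreducibleNodal
    (hΩ : ∀ ⦃Q : Type u⦄ [Group Q] [TopologicalSpace Q] [IsTopologicalGroup Q] (G : PSCDatum Q),
      Ω.IsOfPSCType G → CompactSpace Q ∧ T2Space Q ∧ TotallyDisconnectedSpace Q ∧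
        ∃ (S : Set ℕ) (g r : ℕ) (hg : 1 ≤ g) (ι : PuncturedSurfaceGroup g r →* Q) (e : G.graph.C ≃ Fin r)
          (v₀ : G.graph.V) (n₀ : G.graph.N),
          S.Nonempty ∧ (∀ p ∈ S, p.Prime) ∧ IsProSigmaCompletion S ι ∧ (2 ≤ g ∨ 2 ≤ r) ∧
          (∀ c, G.cuspGp c =
            ((PuncturedSurfaceGroup.cuspInertia (g := g) (e c)).map ι).topologicalClosure) ∧
          (∀ w, w = v₀) ∧ (∀ n, n = n₀) ∧
          G.nodeGp n₀ = ((Subgroup.zpowers (PuncturedSurfaceGroup.b (r := r) (⟨0, hg⟩ : Fin g))).map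
            ι).topologicalClosure ∧
          G.vertGp v₀ = ((Subgroup.closure {x : PuncturedSurfaceGroup g r |
            x = PuncturedSurfaceGroup.b ⟨0, hg⟩ ∨
            x = PuncturedSurfaceGroup.a ⟨0, hg⟩ * PuncturedSurfaceGroup.b ⟨0, hg⟩ * (PuncturedSurfaceGroup.a ⟨0, hg⟩)⁻¹ ∨
            (∃ i : Fin g, 1 ≤ (i : ℕ) ∧ (x = PuncturedSurfaceGroup.a i ∨ x = PuncturedSurfaceGroup.b i)) ∨
            ∃ j : Fin r, x = PuncturedSurfaceGroup.c j}).map ι).topologicalClosure ∧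
          G.genus v₀ = g - 1)
    (hSig : ∀ ⦃Q : Type u⦄ [Group Q] [TopologicalSpace Q] [IsTopologicalGroup Q] (G : PSCDatum Q),
      Ω.IsOfPSCType G → G.Sigma = {l}) :
    NumericallyCuspidalIffHolds Ω :=
  numericallyCuspidalIffHolds_of_characterization Ω l
    (fun _ _ _ _ G hG => ⟨(hΩ G hG).1, (hΩ G hG).2.2.1⟩) hSig
    (openInterDeterminesComponentHolds_of_irreducibleNodal Ω hΩ)
    (cuspidalEdgeLikeCharacterizationHolds_of_cuspidallyStandard Ω fun Q _ _ _ G hG => by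
      obtain ⟨hc, ht, hd, S, g, r, hg, ι, e, v₀, n₀, hne, hprime, hι, hgr, hC, -⟩ := hΩ G hG
      exact ⟨hc, ht, hd, S, g, r, ι, e, hne, hprime,
        by unfold PuncturedSurfaceGroup.IsHyperbolicType; omega, hι, hC⟩)

end Origin

/-! ### The origin with `Σ = {l}`, inhabited by the two-pointed nodal cubic -/

/-- **At the origin of irreducible one-nodal data with `Σ = {l}` — inhabited by the pro-`l` datum of the
TWO-POINTED NODAL CUBIC (`Γ_{1,2}`: one vertex of genus `0`, one node, two marked points) — F-0459,
F-1931 and F-0458 all HOLD.**  Instance forms at data of the shape of genuine irreducible one-nodal curves,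
not the printed theorems for all pointed stable curves.
[cite: MochizukiCombGC2007, Thm 1.6(i) p.13] [cite: MochizukiCombGC2007, Prop 1.2(i) p.8]
[cite: Mochizuki2012, IUTchI Rmk 1.2.3(iv) pp.41-42] -/
theorem exists_irreducibleNodalOrigin_thm16i_holds (l : ℕ) (hl : l.Prime) :
    ∃ Ω : PSCOrigin.{0},
      (∃ (Q : ProfiniteGrp.{0}) (ι : PuncturedSurfaceGroup 1 2 →* Q) (G : PSCDatum Q)
        (e : G.graph.C ≃ Fin 2) (v₀ : G.graph.V) (n₀ : G.graph.N),
        IsProSigmaCompletion {l} ι ∧ Ω.IsOfPSCType G ∧ G.Sigma = {l} ∧ G.graph.i = 1 ∧ G.graph.n = 1 ∧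
          G.graph.r = 2 ∧ (∀ w, w = v₀) ∧ G.genus v₀ = 0 ∧ (∀ n, G.graph.nodeEnds n = s(v₀, v₀)) ∧
          G.nodeGp n₀ = ((Subgroup.zpowers (PuncturedSurfaceGroup.b (r := 2) (0 : Fin 1))).map
            ι).topologicalClosure ∧
          ∀ c, G.cuspGp c =
            ((PuncturedSurfaceGroup.cuspInertia (g := 1) (e c)).map ι).topologicalClosure) ∧
      OpenInterDeterminesComponentHolds Ω ∧ CuspidalEdgeLikeCharacterizationHolds Ω ∧
      NumericallyCuspidalIffHolds Ω := by
  classical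
  let Ω : PSCOrigin.{0} :=
    ⟨fun {Q} _ _ G => ∃ (_ : IsTopologicalGroup Q), G.Sigma = {l} ∧
      (CompactSpace Q ∧ T2Space Q ∧ TotallyDisconnectedSpace Q ∧
        ∃ (S : Set ℕ) (g r : ℕ) (hg : 1 ≤ g) (ι : PuncturedSurfaceGroup g r →* Q) (e : G.graph.C ≃ Fin r)
          (v₀ : G.graph.V) (n₀ : G.graph.N),
          S.Nonempty ∧ (∀ p ∈ S, p.Prime) ∧ IsProSigmaCompletion S ι ∧ (2 ≤ g ∨ 2 ≤ r) ∧
          (∀ c, G.cuspGp c =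
            ((PuncturedSurfaceGroup.cuspInertia (g := g) (e c)).map ι).topologicalClosure) ∧
          (∀ w, w = v₀) ∧ (∀ n, n = n₀) ∧
          G.nodeGp n₀ = ((Subgroup.zpowers (PuncturedSurfaceGroup.b (r := r) (⟨0, hg⟩ : Fin g))).map
            ι).topologicalClosure ∧
          G.vertGp v₀ = ((Subgroup.closure {x : PuncturedSurfaceGroup g r |
            x = PuncturedSurfaceGroup.b ⟨0, hg⟩ ∨
            x = PuncturedSurfaceGroup.a ⟨0, hg⟩ * PuncturedSurfaceGroup.b ⟨0, hg⟩ * (PuncturedSurfaceGroup.a ⟨0, hg⟩)⁻¹ ∨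
            (∃ i : Fin g, 1 ≤ (i : ℕ) ∧ (x = PuncturedSurfaceGroup.a i ∨ x = PuncturedSurfaceGroup.b i)) ∨
            ∃ j : Fin r, x = PuncturedSurfaceGroup.c j}).map ι).topologicalClosure ∧
          G.genus v₀ = g - 1)⟩
  have hΩ : ∀ ⦃Q : Type⦄ [Group Q] [TopologicalSpace Q] [IsTopologicalGroup Q] (G : PSCDatum Q),
      Ω.IsOfPSCType G → CompactSpace Q ∧ T2Space Q ∧ TotallyDisconnectedSpace Q ∧
        ∃ (S : Set ℕ) (g r : ℕ) (hg : 1 ≤ g) (ι : PuncturedSurfaceGroup g r →* Q) (e : G.graph.C ≃ Fin r)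
          (v₀ : G.graph.V) (n₀ : G.graph.N),
          S.Nonempty ∧ (∀ p ∈ S, p.Prime) ∧ IsProSigmaCompletion S ι ∧ (2 ≤ g ∨ 2 ≤ r) ∧
          (∀ c, G.cuspGp c =
            ((PuncturedSurfaceGroup.cuspInertia (g := g) (e c)).map ι).topologicalClosure) ∧
          (∀ w, w = v₀) ∧ (∀ n, n = n₀) ∧
          G.nodeGp n₀ = ((Subgroup.zpowers (PuncturedSurfaceGroup.b (r := r) (⟨0, hg⟩ : Fin g))).map
            ι).topologicalClosure ∧
          G.vertGp v₀ = ((Subgroup.closure {x : PuncturedSurfaceGroup g r |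
            x = PuncturedSurfaceGroup.b ⟨0, hg⟩ ∨
            x = PuncturedSurfaceGroup.a ⟨0, hg⟩ * PuncturedSurfaceGroup.b ⟨0, hg⟩ * (PuncturedSurfaceGroup.a ⟨0, hg⟩)⁻¹ ∨
            (∃ i : Fin g, 1 ≤ (i : ℕ) ∧ (x = PuncturedSurfaceGroup.a i ∨ x = PuncturedSurfaceGroup.b i)) ∨
            ∃ j : Fin r, x = PuncturedSurfaceGroup.c j}).map ι).topologicalClosure ∧
          G.genus v₀ = g - 1 :=
    fun Q _ _ _ G hG => hG.2.2
  have hSig : ∀ ⦃Q : Type⦄ [Group Q] [TopologicalSpace Q] [IsTopologicalGroup Q] (G : PSCDatum Q),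
      Ω.IsOfPSCType G → G.Sigma = {l} := fun Q _ _ _ G hG => hG.2.1
  have hl' : ∀ p ∈ ({l} : Set ℕ), p.Prime := fun p hp => by
    rw [Set.mem_singleton_iff.mp hp]; exact hl
  refine ⟨Ω, ?_, openInterDeterminesComponentHolds_of_irreducibleNodal Ω hΩ,
    cuspidalEdgeLikeCharacterizationHolds_of_cuspidallyStandard Ω (fun Q _ _ _ G hG => ?_),
    numericallyCuspidalIffHolds_of_irreducibleNodal Ω l hΩ hSig⟩
  · obtain ⟨Q, ι, G, e, v₀, n₀, hι, hS, hi, hn, hr, hC, hV, hN, hE, hV₀, hgen, hends⟩ :=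
      exists_irreducibleNodalDatum {l} ⟨l, rfl⟩ hl' 1 2 le_rfl
    have hG : Ω.IsOfPSCType G := ⟨inferInstance, hS, inferInstance, inferInstance, inferInstance, {l}, 1, 2,
      le_rfl, ι, e, v₀, n₀, ⟨l, rfl⟩, hl', hι, Or.inr le_rfl, hC, hV, hN, hE, hV₀, hgen⟩
    exact ⟨Q, ι, G, e, v₀, n₀, hι, hG, hS, hi, hn, hr, hV, hgen, hends, hE, hC⟩
  · obtain ⟨hc, ht, hd, S, g, r, hg, ι, e, v₀, n₀, hne, hprime, hι, hgr, hC, -⟩ := hΩ G hG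
    exact ⟨hc, ht, hd, S, g, r, ι, e, hne, hprime,
      by unfold PuncturedSurfaceGroup.IsHyperbolicType; omega, hι, hC⟩

end PSCDatum

end Literature.AnabelianGeometry.SemiGraphs

end
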